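import Literature.MathematicalPhysics.QuantumLattice.XYGriffithsBLUSchwinger
import Literature.MathematicalPhysics.QuantumLattice.FinDimSpectrumGibbsLimitProofs
import Literature.MathematicalPhysics.QuantumLattice.SpinChainsAkltCorrelationProofs
import Literature.MathematicalPhysics.QuantumLattice.SpinHalfCasimirBound
import HarnessLib

/-!
# Griffiths–Ginibre inequalities of the second kind for GROUND STATES of the spin-½ quantum XY model

Companion of `XYGriffithsBLUSchwinger.lean` (BLU Theorem 1 for Gibbs states). Source: C. Benassi,
B. Lees, D. Ueltschi, *Correlation inequalities for the quantum XY model*, J. Stat. Phys. 164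
(2016) 1157–1166 = arXiv:1510.03215, Theorem 1 (first inequality; held, §1 = p0003, §3 = p0005),
and its zero-temperature limit. For the spin-½ pair-plus-field XY Hamiltonian
`H = xyPairFieldHamiltonian G K₀ K₁ h₀ h₁` with nonnegative coefficients and observables `a, b`
whose `a₋, b₋` lie in Ginibre's cone (all products `Π_{x∈A} Sˣ_x` do):

* `xy_re_groundStateFunctional_truncated_nonneg` — **ground-state GKS-II, tracial form**:
  `Re[ω₀(ab) - ω₀(a) ω₀(b)] ≥ 0` for the tracial ground-state functional
  `ω₀ = lim_{β→∞} ⟨·⟩_β` (`Matrix.groundStateFunctional`; the limit is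
  `Matrix.tendsto_gibbsState_atTop`). No uniqueness is needed: the Gibbs inequality at `s = 0`,
  `⟨ab⟩_β - ⟨a⟩_β⟨b⟩_β ≥ 0` (`xy_schwinger_sub_nonneg`), passes to the limit.
* `xy_re_groundState_truncated_nonneg` — **vector form for a unique ground state**: if the ground
  state is non-degenerate (`Matrix.HasUniqueGroundState`) and `ψ` is a normalised ground vector,
  `Re[⟨ψ, ab ψ⟩ - ⟨ψ, a ψ⟩⟨ψ, b ψ⟩] ≥ 0`.
* `xy_groundState_spinX_triangle` — the **two-point ("triangle") instance**: for sites `x, y, z`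
  and a normalised non-degenerate ground vector `ψ`,
  `Re⟨ψ, Sˣ_xSˣ_y ψ⟩ · Re⟨ψ, Sˣ_ySˣ_z ψ⟩ ≤ ¼ Re⟨ψ, Sˣ_xSˣ_z ψ⟩` (take `a = Sˣ_xSˣ_y`, `b = Sˣ_ySˣ_z`,
  `(Sˣ_y)² = ¼`): with `K(x,y) = 2⟨Sˣ_xSˣ_y⟩` and `K(y,y) = ½` this says
  `K(x,y) K(y,z) ≤ K(y,y) K(x,z)`, i.e. `d = log (K(0)/K)` satisfies the triangle inequality for a
  translation-invariant ground state — the form used by route `LevyLogBootstrap` of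
  `HubbardSuperconductivity` (crux `Block2InfDivXXZ`, support file `…GriffithsCorner.lean`).

Printed for Gibbs states and general multi-spin couplings; the ground-state statements are the
`β → ∞` limits (BLU state the `S = 1` result, Thm. 3, in exactly this limit form). Not here: the
second inequalities (`Π_B S²`, sign `≤ 0`), `Δ ≠ 0` (the easy-plane XXZ anisotropy `+|Δ| SᶻSᶻ` is
NOT covered by Ginibre's cone: `(SᶻSᶻ)(SˣSˣ)`-type mixed monomials break the parity bookkeeping —
an open question, cf. the evidence note of the route), uniqueness of the XY ground state itself
(model-specific; for even tori it is in the `HubbardSuperconductivity` Theorems tree).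

## References

* C. Benassi, B. Lees, D. Ueltschi, J. Stat. Phys. 164 (2016) 1157 = arXiv:1510.03215, Thm. 1
  (and Thm. 3 for the ground-state limit form). [BenassiLeesUeltschi2016]
* J. Ginibre, Comm. Math. Phys. 16 (1970) 310–328. [Ginibre1970]
-/

noncomputable section

namespace Literature.MathematicalPhysics.QuantumLattice

open Matrix Complex Filter
open scoped Kronecker ComplexOrder Topology

section GroundState

variable {Λ : Type*} [Fintype Λ] [DecidableEq Λ]

/-- BLU Theorem 1 at `s = 0`: `Re[⟨ab⟩_β - ⟨a⟩_β ⟨b⟩_β] ≥ 0` for the spin-½ XY model with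
nonnegative couplings and cone observables, `β ≥ 0`. [cite: BenassiLeesUeltschi2016, Thm. 1] -/
theorem xy_re_gibbsState_truncated_nonneg (G : SimpleGraph Λ) [DecidableRel G.Adj]
    {K₀ K₁ : Sym2 Λ → ℝ} {h₀ h₁ : Λ → ℝ} (hK₀ : ∀ e, 0 ≤ K₀ e) (hK₁ : ∀ e, 0 ≤ K₁ e)
    (hh₀ : ∀ x, 0 ≤ h₀ x) (hh₁ : ∀ x, 0 ≤ h₁ x) {a b : Op Λ 2}
    (ha : ∀ i j, 0 ≤ ginibreConj Λ (dblMinus Λ a) i j)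
    (hb : ∀ i j, 0 ≤ ginibreConj Λ (dblMinus Λ b) i j) {β : ℝ} (hβ : 0 ≤ β) :
    0 ≤ (gibbsState β (xyPairFieldHamiltonian G K₀ K₁ h₀ h₁) (a * b) -
        gibbsState β (xyPairFieldHamiltonian G K₀ K₁ h₀ h₁) a *
          gibbsState β (xyPairFieldHamiltonian G K₀ K₁ h₀ h₁) b).re := by
  have h := xy_schwinger_sub_nonneg G hK₀ hK₁ hh₀ hh₁ ha hb hβ le_rfl zero_le_one
  rw [zero_mul, gibbsWeight_zero, Matrix.mul_one, sub_zero, one_mul] at h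
  have hab : (partitionFn β (xyPairFieldHamiltonian G K₀ K₁ h₀ h₁))⁻¹ *
      (a * b * gibbsWeight β (xyPairFieldHamiltonian G K₀ K₁ h₀ h₁)).trace =
        gibbsState β (xyPairFieldHamiltonian G K₀ K₁ h₀ h₁) (a * b) := by
    rw [gibbsState_apply, Matrix.trace_mul_comm]
  rw [hab] at h
  exact (Complex.nonneg_iff.mp h).1

/-- **Ground-state GKS-II for the spin-½ XY model, tracial form** (zero-temperature limit of BLU
Theorem 1): for nonnegative couplings/fields and observables `a, b` with `a₋, b₋` in Ginibre's
cone, the tracial ground-state functional `ω₀` of `H = xyPairFieldHamiltonian G K₀ K₁ h₀ h₁`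
satisfies `Re[ω₀(ab) - ω₀(a) ω₀(b)] ≥ 0`. [cite: BenassiLeesUeltschi2016, Thm. 1 (β → ∞ limit, cf. Thm. 3)] -/
theorem xy_re_groundStateFunctional_truncated_nonneg (G : SimpleGraph Λ) [DecidableRel G.Adj]
    {K₀ K₁ : Sym2 Λ → ℝ} {h₀ h₁ : Λ → ℝ} (hK₀ : ∀ e, 0 ≤ K₀ e) (hK₁ : ∀ e, 0 ≤ K₁ e)
    (hh₀ : ∀ x, 0 ≤ h₀ x) (hh₁ : ∀ x, 0 ≤ h₁ x) {a b : Op Λ 2}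
    (ha : ∀ i j, 0 ≤ ginibreConj Λ (dblMinus Λ a) i j)
    (hb : ∀ i j, 0 ≤ ginibreConj Λ (dblMinus Λ b) i j) :
    0 ≤ ((xyPairFieldHamiltonian G K₀ K₁ h₀ h₁).groundStateFunctional (a * b) -
        (xyPairFieldHamiltonian G K₀ K₁ h₀ h₁).groundStateFunctional a *
          (xyPairFieldHamiltonian G K₀ K₁ h₀ h₁).groundStateFunctional b).re := by
  set H := xyPairFieldHamiltonian G K₀ K₁ h₀ h₁ with hHdef
  have hH : H.IsHermitian := GinibreXY.xyPairFieldHamiltonian_isHermitian G K₀ K₁ h₀ h₁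
  -- the three Gibbs expectations converge to the ground-state functional
  have hT : ∀ A : Op Λ 2, Tendsto (fun β : ℝ => gibbsState β H A) atTop
      (𝓝 (H.groundStateFunctional A)) := fun A => tendsto_gibbsState_atTop_holds hH A
  have hlim : Tendsto (fun β : ℝ => (gibbsState β H (a * b) -
      gibbsState β H a * gibbsState β H b).re) atTop
      (𝓝 ((H.groundStateFunctional (a * b) -
        H.groundStateFunctional a * H.groundStateFunctional b).re)) :=
    (Complex.continuous_re.tendsto _).comp (((hT (a * b)).sub ((hT a).mul (hT b))))
  refine ge_of_tendsto hlim (Filter.eventually_atTop.2 ⟨0, fun β hβ => ?_⟩)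
  exact xy_re_gibbsState_truncated_nonneg G hK₀ hK₁ hh₀ hh₁ ha hb hβ

/-- The expectation of a Hermitian matrix in any vector is real. [folklore] -/
theorem im_star_dotProduct_mulVec_of_isHermitian {n : Type*} [Fintype n] {A : Matrix n n ℂ}
    (hA : A.IsHermitian) (ψ : n → ℂ) : (star ψ ⬝ᵥ A *ᵥ ψ).im = 0 := by
  have h : star (star ψ ⬝ᵥ A *ᵥ ψ) = star ψ ⬝ᵥ A *ᵥ ψ := by
    conv_lhs => rw [star_dotProduct, star_star, star_mulVec, ← dotProduct_mulVec, hA.eq]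
  have := congrArg Complex.im h
  rw [Complex.star_def, Complex.conj_im] at this
  linarith

/-- **Ground-state GKS-II for the spin-½ XY model, vector form for a non-degenerate ground
state**: if `H = xyPairFieldHamiltonian G K₀ K₁ h₀ h₁` (nonnegative coefficients) has a unique
ground state and `ψ` is a normalised ground vector, then for cone observables `a, b`,
`Re[⟨ψ, ab ψ⟩ - ⟨ψ, a ψ⟩⟨ψ, b ψ⟩] ≥ 0`. [cite: BenassiLeesUeltschi2016, Thm. 1 (β → ∞ limit, cf. Thm. 3)] -/
theorem xy_re_groundState_truncated_nonneg (G : SimpleGraph Λ) [DecidableRel G.Adj]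
    {K₀ K₁ : Sym2 Λ → ℝ} {h₀ h₁ : Λ → ℝ} (hK₀ : ∀ e, 0 ≤ K₀ e) (hK₁ : ∀ e, 0 ≤ K₁ e)
    (hh₀ : ∀ x, 0 ≤ h₀ x) (hh₁ : ∀ x, 0 ≤ h₁ x) {a b : Op Λ 2}
    (ha : ∀ i j, 0 ≤ ginibreConj Λ (dblMinus Λ a) i j)
    (hb : ∀ i j, 0 ≤ ginibreConj Λ (dblMinus Λ b) i j)
    (hU : (xyPairFieldHamiltonian G K₀ K₁ h₀ h₁).HasUniqueGroundState)
    {ψ : TensorIndex Λ 2 → ℂ} (hψ : ψ ∈ (xyPairFieldHamiltonian G K₀ K₁ h₀ h₁).groundSpace)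
    (hnorm : star ψ ⬝ᵥ ψ = 1) :
    0 ≤ (star ψ ⬝ᵥ (a * b) *ᵥ ψ - (star ψ ⬝ᵥ a *ᵥ ψ) * (star ψ ⬝ᵥ b *ᵥ ψ)).re := by
  have hψ0 : ψ ≠ 0 := by
    rintro rfl
    simp at hnorm
  have h := xy_re_groundStateFunctional_truncated_nonneg G hK₀ hK₁ hh₀ hh₁ ha hb
  rwa [groundStateFunctional_eq_of_hasUniqueGroundState hU hψ hψ0,
    groundStateFunctional_eq_of_hasUniqueGroundState hU hψ hψ0,
    groundStateFunctional_eq_of_hasUniqueGroundState hU hψ hψ0, hnorm, div_one, div_one,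
    div_one] at h

/-- `Sˣ_x Sˣ_y` lies in Ginibre's cone (its `(·)₋` is entrywise nonnegative in the good basis),
by Lemma 8 for each factor and Lemma 7 for the product. [cite: BenassiLeesUeltschi2016, Lemmas 7–8] -/
theorem entrywise_nonneg_ginibreConj_dblMinus_spinX_mul (x y : Λ) :
    ∀ i j, 0 ≤ ginibreConj Λ (dblMinus Λ (siteSpin 1 x 0 * siteSpin 1 y 0)) i j :=
  (ginibreCone_mul (ginibreCone_siteSpin_zero x) (ginibreCone_siteSpin_zero y)).2

/-- `Sˣ_x Sˣ_y Sˣ_y Sˣ_z = ¼ Sˣ_x Sˣ_z` for spin ½. [folklore] -/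
theorem spinX_mul_spinX_mul_self_mul (x y z : Λ) :
    (siteSpin 1 x 0 * siteSpin 1 y 0 * (siteSpin 1 y 0 * siteSpin 1 z 0) : Op Λ 2) =
      (1 / 4 : ℂ) • (siteSpin 1 x 0 * siteSpin 1 z 0) := by
  rw [Matrix.mul_assoc, ← Matrix.mul_assoc (siteSpin 1 y 0), siteSpin_one_mul_self,
    smul_mul_assoc, Matrix.one_mul, Matrix.mul_smul]

/-- For `x ≠ y` the product `Sˣ_x Sˣ_y` is Hermitian; for `x = y` it is `¼`. Either way its
expectation is real. [folklore] -/
theorem im_expect_spinX_mul (x y : Λ) (ψ : TensorIndex Λ 2 → ℂ) :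
    (star ψ ⬝ᵥ (siteSpin 1 x 0 * siteSpin 1 y 0) *ᵥ ψ).im = 0 := by
  by_cases hxy : x = y
  · subst hxy
    rw [siteSpin_one_mul_self, Matrix.smul_mulVec, Matrix.one_mulVec, dotProduct_smul,
      smul_eq_mul]
    have h1 := im_star_dotProduct_mulVec_of_isHermitian
      (Matrix.isHermitian_one (n := TensorIndex Λ 2) (α := ℂ)) ψ
    rw [Matrix.one_mulVec] at h1
    simp [Complex.mul_im, h1]
  · refine im_star_dotProduct_mulVec_of_isHermitian ?_ ψ
    have hx := (siteSpin_isHermitian (Λ := Λ) 1 x 0).eq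
    have hy := (siteSpin_isHermitian (Λ := Λ) 1 y 0).eq
    rw [IsHermitian, conjTranspose_mul, hx, hy, siteSpin, siteSpin,
      onSite_mul_onSite_comm (Ne.symm hxy)]

/-- **Griffiths "triangle" inequality for a non-degenerate XY ground state.** For the spin-½
pair-plus-field XY Hamiltonian with nonnegative coefficients, a unique ground state and a
normalised ground vector `ψ`, and any sites `x, y, z`:
`Re⟨ψ, Sˣ_xSˣ_y ψ⟩ · Re⟨ψ, Sˣ_ySˣ_z ψ⟩ ≤ ¼ Re⟨ψ, Sˣ_xSˣ_z ψ⟩` — GKS-II with `a = Sˣ_xSˣ_y`,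
`b = Sˣ_ySˣ_z` and `(Sˣ_y)² = ¼`. In terms of the transverse kernel `K = 2⟨SˣSˣ⟩` (`K(y,y) = ½`):
`K(x,y) K(y,z) ≤ K(y,y) K(x,z)`, so `log (K(y,y)/K)` is subadditive along translations of a
translation-invariant ground state. [cite: BenassiLeesUeltschi2016, Thm. 1 (β → ∞ limit, cf. Thm. 3)] -/
theorem xy_groundState_spinX_triangle (G : SimpleGraph Λ) [DecidableRel G.Adj]
    {K₀ K₁ : Sym2 Λ → ℝ} {h₀ h₁ : Λ → ℝ} (hK₀ : ∀ e, 0 ≤ K₀ e) (hK₁ : ∀ e, 0 ≤ K₁ e)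
    (hh₀ : ∀ x, 0 ≤ h₀ x) (hh₁ : ∀ x, 0 ≤ h₁ x)
    (hU : (xyPairFieldHamiltonian G K₀ K₁ h₀ h₁).HasUniqueGroundState)
    {ψ : TensorIndex Λ 2 → ℂ} (hψ : ψ ∈ (xyPairFieldHamiltonian G K₀ K₁ h₀ h₁).groundSpace)
    (hnorm : star ψ ⬝ᵥ ψ = 1) (x y z : Λ) :
    (star ψ ⬝ᵥ (siteSpin 1 x 0 * siteSpin 1 y 0) *ᵥ ψ).re *
        (star ψ ⬝ᵥ (siteSpin 1 y 0 * siteSpin 1 z 0) *ᵥ ψ).re ≤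
      1 / 4 * (star ψ ⬝ᵥ (siteSpin 1 x 0 * siteSpin 1 z 0) *ᵥ ψ).re := by
  have h := xy_re_groundState_truncated_nonneg G hK₀ hK₁ hh₀ hh₁
    (entrywise_nonneg_ginibreConj_dblMinus_spinX_mul x y)
    (entrywise_nonneg_ginibreConj_dblMinus_spinX_mul y z) hU hψ hnorm
  rw [spinX_mul_spinX_mul_self_mul, Matrix.smul_mulVec, dotProduct_smul, smul_eq_mul,
    Complex.sub_re, Complex.mul_re, Complex.mul_re, im_expect_spinX_mul x y,
    im_expect_spinX_mul y z] at h
  norm_num at h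
  linarith

end GroundState

end Literature.MathematicalPhysics.QuantumLattice

end
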